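/-
Copyright (c) 2026 the pub-hodgecm-mathlib formalisation cell (harness21).  Prover seat hodgecm-mathlib-K2E2-p12 (g5): Track B «K2-LIT», ENGINE E1,
h413 = stmt-HodgeConjecture-24833; DEAL (q10) «R7₃-SCALAR» FILE 2 of the dealer K2E1-plan (g4) 2026-09-04T07:52:58Z — the N = 3 local-factor identification,
coordinate level (transport to E1's adelic height = FILE 2(b)).
-/
import Summits.HodgeConjecture.HodgeConjecture.Theorems.K2E1GindikinKarpelevichSplitGL3   -- ★ (q6) GK for `GL₃` (split places): floor lemma `integral_max_one_max_normAbs_rpow_neg`, `integral_bigCell_spherical_gl3_eq`; brings ★ p858040 `integral_max_one_normAbs_rpow_neg`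
import Literature.NumberTheory.Automorphic.AddCharConductorExponent                        -- ★ `exists_normAbs_eq_inv_zpow`, `exists_normAbs_eq_inv_zpow_of_int` (the value group `q^ℤ` of `‖·‖`)
import Literature.NumberTheory.Automorphic.AdicCompletionResidueCard                       -- ★ `residueFieldCard_adicCompletion_eq : residueFieldCard (v.adicCompletion K) = v.residueCard`
import HarnessLib

/-!
# K2·E1 — `K2E1IntertwiningLocalFactorU3` ((q10) «R7₃-SCALAR» FILE 2): THE LOCAL FACTORS OF THE `U(J₃) = U(2,1)` INTERTWINING CONSTANT —
# INERT TYPE `∫_E ∫_F max(1, ‖X‖_E, |t|_F)^{−2σ} dt dX = G_F(2σ)·G_E(2σ−1) = μμ′·(1−q^{−2σ})(1+q^{−(2σ−1)})∕[(1−q^{−(2σ−2)})(1+q^{−(2σ−2)})]` (`q_E = q²`),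
# SPLIT TYPE = ★ Gindikin–Karpelevich for `GL₃` — both LITERALLY FILE 1's Euler factor at `ε_v = −1` resp. `ε_v = +1`

Track B ∕ K2-LIT, crux h413 = `stmt-HodgeConjecture-24833`, route of record `HCCMUnconditional`; cell `hodgecm-mathlib`, squad K2, ENGINE E1 (campaign «EIS-RANK-ONE»,
ceiling R7 at `N = 3`).  DEAL (q10) FILE 2 (K2E1-plan (g4) 07:52:58Z; census memo `CENSUS-q10-R73-SCALAR-U3.K2E1b-plan-g5.md` §1).  THEOREMS ONLY (no `def`, no instance,
no notation, no named-fact hypothesis, no `sorry`; default heartbeats); lane `--supports stmt-HodgeConjecture-24833 --as helper` (count-neutral).  CURRENCY = ★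
`K2E1GindikinKarpelevichSplitGL3`'s: coordinates over non-archimedean local fields, `normAbs`, ANY additive Haar measures, `μ.real (primePowBall _ 0) = μ(𝒪)`,
`residueFieldCard`, REAL `σ`, ITERATED Bochner integrals (integrability-free identities).

THE MATHEMATICS [Langlands1971, §3; MoeglinWaldspurger1995, II.1.7, IV.1.11; Rogawski1990, §4.5; Casselman1980, Thm. 3.1].  At a finite place `v` of `F = L⁺` INERT and
unramified in the CM field `L` (`w ∣ v`, `q_w = q_v²`, `v ∤ 2`, `δ` a `v`-unit), the finite height factor of E1's flat spherical section along the big-cell Heisenberg chart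
`u(X, θt)` of `U(J₃)` (★ (a2)₃ `K2E1HeightBigCellLineFormulaU3`: `max(1, |X_w|_w, |z_w|_w)`, `z = tδ − ½X·cX`) equals `max(1, |t|_v, |X|_w)²` (`z + z̄ = −XX̄` forces
`|X|_w² ≤ |z|_w`; `|a + bδ|_w = max(|a|_v, |b|_v)²` in the unramified integral basis — the TRANSPORT, FILE 2(b)), so the local intertwining factor at `v` is the double integral
  `I_v(σ) = ∫_{L_w} ∫_{L⁺_v} max(1, ‖X‖_{L_w}, |t|_v)^{−2σ} dt dX`.
It is a RANK-ONE REDUCTION exactly as Gindikin–Karpelevich: the inner `t`-integral is the floor integral `max(1,‖X‖)^{1−2σ}·G_{L⁺_v}(2σ)` (★ GK `GL₃` §2 — the floor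
`‖X‖_{L_w} ∈ q_v^{2ℤ}` is a value of `|·|_v`), and the outer `X`-integral is Tate's `G_{L_w}(2σ−1)` (★ p858040), `G_K(s) = ∫_K max(1,|x|)^{−s} = μ(𝒪_K)(1−q_K^{−s})∕(1−q_K^{1−s})`:
  **`I_v(σ) = G_{L⁺_v}(2σ)·G_{L_w}(2σ−1)`** — the long root `2a` (`q_{2a} = q_v`) and the short root `a` (`q_a = q_w = q_v²`) of the relative system `{±a, ±2a}` — and with
`q_w = q_v²`:  **`I_v(σ) = μ(𝒪_v)μ(𝒪_w)·(1 − q_v^{−2σ})(1 + q_v^{−(2σ−1)}) ∕ [(1 − q_v^{−(2σ−2)})(1 + q_v^{−(2σ−2)})]`** = Macdonald's `(1 + z∕q_v)(1 − z∕q_v²)∕(1 − z²)` at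
`z = q_v^{−2(σ−1)}` (★ `K2E3SphericalCFunctionMacdonald.integral_cellFun_eq_macdonald_inert`, compared not imported) = `[ζ_{L_w}(σ−1)∕ζ_{L_w}(σ)]·[L_v(2σ−2, ω)∕L_v(2σ−1, ω)]`,
`ω_v = −1` = FILE 1's Euler factor ★ `K2E1IntertwiningScalarContinuationU3.hasProd_localScalar_three` at `ε_v = −1`.  At a SPLIT place the coordinate integral is ★
`K2E1GindikinKarpelevichSplitGL3.integral_bigCell_spherical_gl3_eq` (`μ(𝒪)³·[ζ_v(σ−1)∕ζ_v(σ)]²·ζ_v(2σ−2)∕ζ_v(2σ−1)`) = FILE 1's factor at `ε_v = +1`.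

WHAT IS PROVED (generic non-archimedean local fields `E`, `F`; where said `q_E = q_F²`):
* §1 `exists_normAbs_eq_of_residueFieldCard_eq_sq` (`‖X‖_E` is a value of `|·|_F`), **`integral_max_one_max_rpow_neg_of_sq`** (the floor integral with floor `‖X‖_E`).
* §2 INERT TYPE: **`integral_integral_inertCell_eq_prod`** (`= G_F(2σ)·G_E(2σ−1)`, every real `σ`), **`integral_integral_inertCell_eq`** (closed form, `σ > 1`),
  **`integral_integral_inertCell_eq_localScalar`** (the same in FILE 1's token shape `[(1−q^{−σ})(1−εq^{−σ})(1−εq^{−(2σ−1)})]∕[(1−q^{−(σ−1)})(1−εq^{−(σ−1)})(1−εq^{−(2σ−2)})]`, `ε = −1`).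
* §3 SPLIT TYPE: **`integral_bigCell_spherical_gl3_eq_localScalar`** — ★ GK `GL₃`'s closed form rewritten in FILE 1's token shape at `ε = +1`.
* §4 NUMBER-FIELD READING: **`integral_integral_inertCell_eq_localScalar_adicCompletion`** — §2 at `(E, F) = (L_w, K_v)` for places `w` of `L`, `v` of `K` with
  `N(w) = N(v)²` (for `K = L⁺`, `v` non-split unramified in `L`: ★ `Rogawski1990.absNorm_placesOver_eq_sq_of_nonsplit_of_isUnramifiedIn`), `q` spelled `v.residueCard`.
NOT HERE: FILE 2(b) = the transport of E1's adelic height factor at `v` to these coordinates (inert: the integral-basis norm; split: the linear change `(x₁, x₂, t) ↦ (x₁, −x₂, tδ₁ − ½x₁x₂)`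
to GK's `(x, y, z)`, Jacobian `|δ|_v = 1`); FILE 3 = the Euler product over `v ∉ S` (product formula on `𝔸_{L,f} × 𝔸_{L⁺,f}`).
HONEST LABEL: HC_CM is proved only modulo the 7 printed citations (2 remaining named inputs: hLiu418 = `stmt-HodgeConjecture-24832`, h413 = `stmt-HodgeConjecture-24833`) until rung 0
closes; this file asserts no named fact and closes no socket; count-neutral.

## References
* [Langlands1971] R. P. Langlands, *Euler Products* (Yale, 1971): §3 (the Gindikin–Karpelevich product over positive roots, non-reduced case).
* [MoeglinWaldspurger1995] C. Mœglin, J.-L. Waldspurger, *Spectral Decomposition and Eisenstein Series* (1995): II.1.7, IV.1.11.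
* [Rogawski1990] J. D. Rogawski, *Automorphic Representations of Unitary Groups in Three Variables* (1990): §4.5 p. 45 (`c`-function of quasi-split `U(3)`: `q_a = q²`, `q_{2a} = q`).
* [Casselman1980] W. Casselman, *The unramified principal series of p-adic groups I*, Compositio Math. 40 (1980): Thm. 3.1.
* [Tate1950] J. Tate, *Fourier analysis in number fields and Hecke's zeta-functions* (1950): §2.2 Lemma 2.2.5.
* [NeukirchANT1999] J. Neukirch, *Algebraic Number Theory* (1999): Ch. II Prop. (4.3), §6 (`q_w = q_v^{f(w|v)}`).
-/

set_option autoImplicit false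
set_option linter.dupNamespace false -- the mandated namespace repeats `HodgeConjecture.HodgeConjecture`

noncomputable section

open MeasureTheory Filter Topology Set NumberField IsDedekindDomain
open scoped NNReal ENNReal
open Literature.NumberTheory.GaloisRepresentations.IsNonarchimedeanLocalField
open Literature.NumberTheory.Automorphic Literature.NumberTheory.Automorphic.LocalFieldHaar
open Summit.HodgeConjecture.HodgeConjecture.Cruxes.HLiu418.K2LiuGKRankOneIntegral (one_lt_residueFieldCard_real)
open Summit.HodgeConjecture.HodgeConjecture.Cruxes.H413.K2E1IntertwiningLocalFactorU2 (integral_max_one_normAbs_rpow_neg)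
open Summit.HodgeConjecture.HodgeConjecture.Cruxes.H413.K2E1GindikinKarpelevichSplitGL3 (integral_max_one_max_normAbs_rpow_neg integral_bigCell_spherical_gl3_eq)

namespace Summit.HodgeConjecture.HodgeConjecture.Cruxes.H413.K2E1IntertwiningLocalFactorU3

/-! ## §0 Real-exponent algebra: the two shapes of the local factors -/

/-- **INERT SHAPE** (`q > 1`, `σ > 1`):
`[(1−q^{−2σ})∕(1−q^{−(2σ−1)})]·[(1−(q²)^{−(2σ−1)})∕(1−(q²)^{−(2σ−2)})] = (1−q^{−2σ})(1+q^{−(2σ−1)})∕[(1−q^{−(2σ−2)})(1+q^{−(2σ−2)})]`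
(`(q²)^{−x} = (q^{−x})²`, `1 − u² = (1−u)(1+u)`, `q^{−(2σ−1)} ≠ 1`). [folklore] -/
theorem inert_shape_eq {q : ℝ} (hq : 1 < q) {σ : ℝ} (hσ : 1 < σ) :
    (1 - q ^ (-(2 * σ))) / (1 - q ^ (1 - 2 * σ)) * ((1 - (q ^ 2) ^ (-(2 * σ - 1))) / (1 - (q ^ 2) ^ (1 - (2 * σ - 1)))) =
      (1 - q ^ (-(2 * σ))) * (1 + q ^ (-(2 * σ - 1))) / ((1 - q ^ (-(2 * σ - 2))) * (1 + q ^ (-(2 * σ - 2)))) := by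
  have hq0 : 0 ≤ q := by linarith
  have hsq : ∀ y : ℝ, (q ^ 2) ^ y = (q ^ y) ^ 2 := fun y => by
    rw [show (q ^ 2 : ℝ) = q ^ ((2 : ℕ) : ℝ) by rw [Real.rpow_natCast], ← Real.rpow_mul hq0, mul_comm, Real.rpow_mul_natCast hq0]
  have hu : q ^ (-(2 * σ - 1)) < 1 := Real.rpow_lt_one_of_one_lt_of_neg hq (by linarith)
  have hu1 : 1 - q ^ (-(2 * σ - 1)) ≠ 0 := by linarith
  rw [show (1 : ℝ) - 2 * σ = -(2 * σ - 1) by ring, show (1 : ℝ) - (2 * σ - 1) = -(2 * σ - 2) by ring, hsq, hsq]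
  have h1 : 1 - (q ^ (-(2 * σ - 1))) ^ 2 = (1 - q ^ (-(2 * σ - 1))) * (1 + q ^ (-(2 * σ - 1))) := by ring
  have h2 : 1 - (q ^ (-(2 * σ - 2))) ^ 2 = (1 - q ^ (-(2 * σ - 2))) * (1 + q ^ (-(2 * σ - 2))) := by ring
  rw [h1, h2, div_mul_div_comm,
    show (1 - q ^ (-(2 * σ))) * ((1 - q ^ (-(2 * σ - 1))) * (1 + q ^ (-(2 * σ - 1)))) =
      (1 - q ^ (-(2 * σ - 1))) * ((1 - q ^ (-(2 * σ))) * (1 + q ^ (-(2 * σ - 1)))) by ring,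
    mul_div_mul_left _ _ hu1]

/-- **FILE 1's TOKEN SHAPE AT `ε = −1`** equals the inert shape:
`[(1−q^{−σ})(1+q^{−σ})(1+q^{−(2σ−1)})]∕[(1−q^{−(σ−1)})(1+q^{−(σ−1)})(1+q^{−(2σ−2)})] = (1−q^{−2σ})(1+q^{−(2σ−1)})∕[(1−q^{−(2σ−2)})(1+q^{−(2σ−2)})]` (`q > 0`). [folklore] -/
theorem localScalar_shape_neg_one_eq {q : ℝ} (hq : 0 < q) (σ : ℝ) :
    (1 - q ^ (-σ)) * (1 - (-1) * q ^ (-σ)) * (1 - (-1) * q ^ (-(2 * σ - 1))) /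
        ((1 - q ^ (-(σ - 1))) * (1 - (-1) * q ^ (-(σ - 1))) * (1 - (-1) * q ^ (-(2 * σ - 2)))) =
      (1 - q ^ (-(2 * σ))) * (1 + q ^ (-(2 * σ - 1))) / ((1 - q ^ (-(2 * σ - 2))) * (1 + q ^ (-(2 * σ - 2)))) := by
  have h1 : q ^ (-(2 * σ)) = q ^ (-σ) * q ^ (-σ) := by rw [← Real.rpow_add hq]; ring_nf
  have h2 : q ^ (-(2 * σ - 2)) = q ^ (-(σ - 1)) * q ^ (-(σ - 1)) := by rw [← Real.rpow_add hq]; ring_nf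
  rw [h1, h2]
  ring

/-- **FILE 1's TOKEN SHAPE AT `ε = +1`** equals the Gindikin–Karpelevich shape:
`[(1−q^{−σ})(1−q^{−σ})(1−q^{−(2σ−1)})]∕[(1−q^{−(σ−1)})(1−q^{−(σ−1)})(1−q^{−(2σ−2)})] = [(1−q^{−σ})∕(1−q^{1−σ})]²·(1−q^{−(2σ−1)})∕(1−q^{−(2σ−2)})`. [folklore] -/
theorem localScalar_shape_one_eq (q σ : ℝ) :
    (1 - q ^ (-σ)) * (1 - 1 * q ^ (-σ)) * (1 - 1 * q ^ (-(2 * σ - 1))) /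
        ((1 - q ^ (-(σ - 1))) * (1 - 1 * q ^ (-(σ - 1))) * (1 - 1 * q ^ (-(2 * σ - 2)))) =
      ((1 - q ^ (-σ)) / (1 - q ^ (1 - σ))) ^ 2 * ((1 - q ^ (-(2 * σ - 1))) / (1 - q ^ (-(2 * σ - 2)))) := by
  rw [show (1 : ℝ) - σ = -(σ - 1) by ring, div_pow, div_mul_div_comm]
  ring

section TwoLocalFields

variable {E F : Type*} [Field E] [ValuativeRel E] [TopologicalSpace E] [IsNonarchimedeanLocalField E]
  [Field F] [ValuativeRel F] [TopologicalSpace F] [IsNonarchimedeanLocalField F]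

/-! ## §1 The floor integral with floor `‖X‖_E` when `q_E = q_F²` -/

/-- **`‖X‖_E` is a value of `|·|_F` when `q_E = q_F²`**: `‖X‖_E ∈ {0} ∪ q_E^ℤ = {0} ∪ q_F^{2ℤ} ⊆ |F|` (★ `exists_normAbs_eq_inv_zpow`, ★ `exists_normAbs_eq_inv_zpow_of_int`).
This is the one arithmetic fact behind the rank-one reduction at an inert place (`q_w = q_v²`, unramified). [cite: NeukirchANT1999, Ch. II §6] -/
theorem exists_normAbs_eq_of_residueFieldCard_eq_sq (hq : residueFieldCard E = residueFieldCard F ^ 2) (X : E) :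
    ∃ z : F, ((normAbs F z : ℝ≥0) : ℝ) = ((normAbs E X : ℝ≥0) : ℝ) := by
  by_cases hX : X = 0
  · exact ⟨0, by rw [hX, map_zero, map_zero]⟩
  · obtain ⟨k, hk⟩ := exists_normAbs_eq_inv_zpow hX
    obtain ⟨z, -, hz⟩ := exists_normAbs_eq_inv_zpow_of_int (F := F) (2 * k)
    refine ⟨z, ?_⟩
    rw [hz, hk, hq, Nat.cast_pow]
    congr 1
    rw [zpow_mul, inv_zpow, inv_zpow, zpow_ofNat, inv_zpow]

variable [MeasurableSpace F] [BorelSpace F] (μF : Measure F) [μF.IsAddHaarMeasure]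

/-- **THE FLOOR INTEGRAL WITH FLOOR `‖X‖_E`** (`q_E = q_F²`, every real `s`, unconditional identity of Bochner integrals):
`∫_F max(1, ‖X‖_E, |t|_F)^{−s} dμ_F(t) = max(1, ‖X‖_E)^{1−s} · ∫_F max(1, |t|_F)^{−s} dμ_F(t)` — ★ `K2E1GindikinKarpelevichSplitGL3.integral_max_one_max_normAbs_rpow_neg` at a
`z ∈ F` with `|z|_F = ‖X‖_E` (§1). [cite: Tate1950, §2.2 Lemma 2.2.5] [cite: Casselman1980, Thm. 3.1] -/
theorem integral_max_one_max_rpow_neg_of_sq (hq : residueFieldCard E = residueFieldCard F ^ 2) (X : E) (s : ℝ) :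
    ∫ t, (max 1 (max ((normAbs E X : ℝ≥0) : ℝ) ((normAbs F t : ℝ≥0) : ℝ))) ^ (-s) ∂μF =
      (max 1 ((normAbs E X : ℝ≥0) : ℝ)) ^ (1 - s) * ∫ t, (max 1 ((normAbs F t : ℝ≥0) : ℝ)) ^ (-s) ∂μF := by
  obtain ⟨z, hz⟩ := exists_normAbs_eq_of_residueFieldCard_eq_sq hq X
  rw [← hz]
  exact integral_max_one_max_normAbs_rpow_neg μF z s

/-! ## §2 INERT TYPE: `∫_E ∫_F max(1, ‖X‖_E, |t|_F)^{−2σ} = G_F(2σ)·G_E(2σ−1)` and its closed form -/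

variable [MeasurableSpace E] [BorelSpace E] (μE : Measure E) [μE.IsAddHaarMeasure]

omit [BorelSpace E] [μE.IsAddHaarMeasure] in
/-- **INERT TYPE, PRODUCT FORM** (`q_E = q_F²`, every real `σ`, iterated Bochner integrals): `∫_E ∫_F max(1, ‖X‖_E, |t|_F)^{−2σ} dμ_F dμ_E = G_F(2σ) · G_E(2σ−1)`,
`G_K(s) = ∫_K max(1,|x|_K)^{−s}` — the rank-one reduction of the `U(2,1)` intertwining integral at an inert place: long root `2a ↦ G_F(2σ)` (`q_{2a} = q_F`), short root
`a ↦ G_E(2σ−1)` (`q_a = q_E = q_F²`). [cite: Langlands1971, §3] [cite: Rogawski1990, §4.5 p. 45] [cite: MoeglinWaldspurger1995, II.1.7] -/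
theorem integral_integral_inertCell_eq_prod (hq : residueFieldCard E = residueFieldCard F ^ 2) (σ : ℝ) :
    ∫ X, ∫ t, (max 1 (max ((normAbs E X : ℝ≥0) : ℝ) ((normAbs F t : ℝ≥0) : ℝ))) ^ (-(2 * σ)) ∂μF ∂μE =
      (∫ t, (max 1 ((normAbs F t : ℝ≥0) : ℝ)) ^ (-(2 * σ)) ∂μF) * ∫ X, (max 1 ((normAbs E X : ℝ≥0) : ℝ)) ^ (-(2 * σ - 1)) ∂μE := by
  simp_rw [integral_max_one_max_rpow_neg_of_sq μF hq _ (2 * σ)]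
  rw [integral_mul_const, mul_comm, show (1 : ℝ) - 2 * σ = -(2 * σ - 1) by ring]

/-- **INERT TYPE, CLOSED FORM** (`q_E = q_F²`, `σ > 1`): with `q = q_F`,
`∫_E ∫_F max(1, ‖X‖_E, |t|_F)^{−2σ} dμ_F dμ_E = μ_F(𝒪_F)·μ_E(𝒪_E) · (1 − q^{−2σ})(1 + q^{−(2σ−1)}) ∕ [(1 − q^{−(2σ−2)})(1 + q^{−(2σ−2)})]`
(Tate ★ p858040 twice: `G_F(2σ) = μ(𝒪_F)(1−q^{−2σ})∕(1−q^{1−2σ})`, `G_E(2σ−1) = μ(𝒪_E)(1−q^{−2(2σ−1)})∕(1−q^{−2(2σ−2)})`, §0) — Macdonald's `(1 + z∕q)(1 − z∕q²)∕(1 − z²)`,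
`z = q^{−2(σ−1)}`, i.e. `[ζ_E(σ−1)∕ζ_E(σ)]·[L(2σ−2, ω)∕L(2σ−1, ω)]` with `ζ_E(s) = (1 − q^{−2s})⁻¹`, `L(s, ω) = (1 + q^{−s})⁻¹` (`ω = −1`).
[cite: Rogawski1990, §4.5 p. 45] [cite: MoeglinWaldspurger1995, IV.1.11] [cite: Casselman1980, Thm. 3.1] -/
theorem integral_integral_inertCell_eq (hq : residueFieldCard E = residueFieldCard F ^ 2) {σ : ℝ} (hσ : 1 < σ) :
    ∫ X, ∫ t, (max 1 (max ((normAbs E X : ℝ≥0) : ℝ) ((normAbs F t : ℝ≥0) : ℝ))) ^ (-(2 * σ)) ∂μF ∂μE =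
      μF.real (primePowBall F 0) * μE.real (primePowBall E 0) *
        ((1 - (residueFieldCard F : ℝ) ^ (-(2 * σ))) * (1 + (residueFieldCard F : ℝ) ^ (-(2 * σ - 1))) /
          ((1 - (residueFieldCard F : ℝ) ^ (-(2 * σ - 2))) * (1 + (residueFieldCard F : ℝ) ^ (-(2 * σ - 2))))) := by
  rw [integral_integral_inertCell_eq_prod μF μE hq σ, integral_max_one_normAbs_rpow_neg μF (by linarith : 1 < 2 * σ),
    integral_max_one_normAbs_rpow_neg μE (by linarith : 1 < 2 * σ - 1), hq, ← inert_shape_eq (one_lt_residueFieldCard_real (F := F)) hσ]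
  push_cast
  ring

/-- **INERT TYPE IN FILE 1's TOKENS** (`q_E = q_F²`, `σ > 1`): `μ_F(𝒪_F)⁻¹ μ_E(𝒪_E)⁻¹·∫_E ∫_F max(1, ‖X‖_E, |t|_F)^{−2σ}` equals
`[(1 − q^{−σ})(1 − ε q^{−σ})(1 − ε q^{−(2σ−1)})] ∕ [(1 − q^{−(σ−1)})(1 − ε q^{−(σ−1)})(1 − ε q^{−(2σ−2)})]` at `ε = −1` — VERBATIM the `v`-term of ★
`K2E1IntertwiningScalarContinuationU3.hasProd_localScalar_three` at an inert place (`ε_v = ε_{L∕L⁺}(ϖ_v) = −1`), in real currency.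
[cite: Rogawski1990, §4.5 p. 45] [cite: MoeglinWaldspurger1995, IV.1.11] -/
theorem integral_integral_inertCell_eq_localScalar (hq : residueFieldCard E = residueFieldCard F ^ 2) {σ : ℝ} (hσ : 1 < σ) :
    ∫ X, ∫ t, (max 1 (max ((normAbs E X : ℝ≥0) : ℝ) ((normAbs F t : ℝ≥0) : ℝ))) ^ (-(2 * σ)) ∂μF ∂μE =
      μF.real (primePowBall F 0) * μE.real (primePowBall E 0) *
        ((1 - (residueFieldCard F : ℝ) ^ (-σ)) * (1 - (-1) * (residueFieldCard F : ℝ) ^ (-σ)) * (1 - (-1) * (residueFieldCard F : ℝ) ^ (-(2 * σ - 1))) /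
          ((1 - (residueFieldCard F : ℝ) ^ (-(σ - 1))) * (1 - (-1) * (residueFieldCard F : ℝ) ^ (-(σ - 1))) *
            (1 - (-1) * (residueFieldCard F : ℝ) ^ (-(2 * σ - 2))))) := by
  rw [integral_integral_inertCell_eq μF μE hq hσ, localScalar_shape_neg_one_eq (one_pos.trans (one_lt_residueFieldCard_real (F := F))) σ]

end TwoLocalFields

/-! ## §3 SPLIT TYPE: ★ Gindikin–Karpelevich for `GL₃` in FILE 1's tokens -/

section Split

variable {F : Type*} [Field F] [ValuativeRel F] [TopologicalSpace F] [IsNonarchimedeanLocalField F]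
  [MeasurableSpace F] [BorelSpace F] (μ : Measure F) [μ.IsAddHaarMeasure]

/-- **SPLIT TYPE IN FILE 1's TOKENS** (`σ > 1`): ★ `K2E1GindikinKarpelevichSplitGL3.integral_bigCell_spherical_gl3_eq` rewritten —
`∫_x ∫_z ∫_y (max(1,|x|,|z|)·max(1,|y|,|z−xy|))^{−σ} = μ(𝒪)³ · [(1 − q^{−σ})(1 − ε q^{−σ})(1 − ε q^{−(2σ−1)})] ∕ [(1 − q^{−(σ−1)})(1 − ε q^{−(σ−1)})(1 − ε q^{−(2σ−2)})]`
at `ε = +1` — VERBATIM the `v`-term of ★ `K2E1IntertwiningScalarContinuationU3.hasProd_localScalar_three` at a split place (`ε_v = +1`), in real currency.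
[cite: Langlands1971, §3] [cite: Casselman1980, Thm. 3.1] [cite: MoeglinWaldspurger1995, IV.1.11] -/
theorem integral_bigCell_spherical_gl3_eq_localScalar {σ : ℝ} (hσ : 1 < σ) :
    ∫ x, ∫ z, ∫ y, (max 1 (max ((normAbs F x : ℝ≥0) : ℝ) ((normAbs F z : ℝ≥0) : ℝ))) ^ (-σ) *
        (max 1 (max ((normAbs F y : ℝ≥0) : ℝ) ((normAbs F (z - x * y) : ℝ≥0) : ℝ))) ^ (-σ) ∂μ ∂μ ∂μ =
      μ.real (primePowBall F 0) ^ 3 *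
        ((1 - (residueFieldCard F : ℝ) ^ (-σ)) * (1 - 1 * (residueFieldCard F : ℝ) ^ (-σ)) * (1 - 1 * (residueFieldCard F : ℝ) ^ (-(2 * σ - 1))) /
          ((1 - (residueFieldCard F : ℝ) ^ (-(σ - 1))) * (1 - 1 * (residueFieldCard F : ℝ) ^ (-(σ - 1))) *
            (1 - 1 * (residueFieldCard F : ℝ) ^ (-(2 * σ - 2))))) := by
  rw [integral_bigCell_spherical_gl3_eq μ hσ, localScalar_shape_one_eq]

end Split

/-! ## §4 The number-field reading: `(E, F) = (L_w, K_v)` with `N(w) = N(v)²` -/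

section Place

variable {K L : Type} [Field K] [NumberField K] [Field L] [NumberField L]
  (v : HeightOneSpectrum (𝓞 K)) (w : HeightOneSpectrum (𝓞 L))
  [MeasurableSpace (v.adicCompletion K)] [BorelSpace (v.adicCompletion K)] (μv : Measure (v.adicCompletion K)) [μv.IsAddHaarMeasure]
  [MeasurableSpace (w.adicCompletion L)] [BorelSpace (w.adicCompletion L)] (μw : Measure (w.adicCompletion L)) [μw.IsAddHaarMeasure]

/-- **THE INERT LOCAL FACTOR AT A PLACE, IN FILE 1's TOKENS.**  For finite places `v` of `K` and `w` of `L` with `N(w) = N(v)²` (the case `K = L⁺`, `w ∣ v` non-split and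
unramified in the CM field `L`: ★ `Rogawski1990.absNorm_placesOver_eq_sq_of_nonsplit_of_isUnramifiedIn`), any additive Haar measures, and real `σ > 1`:
`∫_{L_w} ∫_{K_v} max(1, ‖X‖_w, |t|_v)^{−2σ} dμ_v dμ_w = μ_v(𝒪_v)μ_w(𝒪_w) · [(1 − N(v)^{−σ})(1 − ε N(v)^{−σ})(1 − ε N(v)^{−(2σ−1)})] ∕ [(1 − N(v)^{−(σ−1)})(1 − ε N(v)^{−(σ−1)})(1 − ε N(v)^{−(2σ−2)})]`
at `ε = −1`, `N(v) = v.residueCard` (★ `residueFieldCard_adicCompletion_eq`) — with `μ_v(𝒪_v)μ_w(𝒪_w) = 1` this IS the inert `v`-term of `c^S(σ)`.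
[cite: Rogawski1990, §4.5 p. 45] [cite: NeukirchANT1999, Ch. II Prop. (4.3), §6] [cite: MoeglinWaldspurger1995, IV.1.11] -/
theorem integral_integral_inertCell_eq_localScalar_adicCompletion (hq : w.residueCard = v.residueCard ^ 2) {σ : ℝ} (hσ : 1 < σ) :
    ∫ X, ∫ t, (max 1 (max ((normAbs (w.adicCompletion L) X : ℝ≥0) : ℝ) ((normAbs (v.adicCompletion K) t : ℝ≥0) : ℝ))) ^ (-(2 * σ)) ∂μv ∂μw =
      μv.real (primePowBall (v.adicCompletion K) 0) * μw.real (primePowBall (w.adicCompletion L) 0) *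
        ((1 - (v.residueCard : ℝ) ^ (-σ)) * (1 - (-1) * (v.residueCard : ℝ) ^ (-σ)) * (1 - (-1) * (v.residueCard : ℝ) ^ (-(2 * σ - 1))) /
          ((1 - (v.residueCard : ℝ) ^ (-(σ - 1))) * (1 - (-1) * (v.residueCard : ℝ) ^ (-(σ - 1))) *
            (1 - (-1) * (v.residueCard : ℝ) ^ (-(2 * σ - 2))))) := by
  have hq' : residueFieldCard (w.adicCompletion L) = residueFieldCard (v.adicCompletion K) ^ 2 := by
    rw [residueFieldCard_adicCompletion_eq, residueFieldCard_adicCompletion_eq, hq]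
  rw [integral_integral_inertCell_eq_localScalar μv μw hq' hσ, residueFieldCard_adicCompletion_eq]

end Place

/-! ## §5 (ED. 2) INERT TYPE IN BASE COORDINATES `(a, b, t) ∈ F³`: `∫_a ∫_b ∫_t max(1, max(|a|,|b|)², |t|)^{−2σ} = G(2σ)·G(4σ−2)·G(4σ−3)`

After the finite-adelic basis transport `X = a + b·δ` (`𝔸_{L,f} ≅ 𝔸_{L⁺,f}²`, brick «ADELIC-BASIS-TRANSPORT» of K2-defs1 (g5)) the inert local factor reaches FILE 3 as an
integral over `(L⁺_v)³` — the currency of ★ `AdelicProductIntegral` at `ι = Fin 3` — with integrand `max(1, |t|_v, |ι_w a + ι_w b·δ_w|_w)^{−2σ}` and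
`|ι_w a + ι_w b·δ_w|_w = max(|a|_v, |b|_v)²` (integral basis at `v ∤ 2`, `δ` a `v`-unit; FILE 2(b)).  In these coordinates the factor is a rank-one reduction over ONE
local field: floor `max(|a|,|b|)² = |a²|` or `|b²|` for the `t`-integral, floor `|a|` for the `b`-integral, and `G(4σ−3)·G(4σ−2) = μ(𝒪)²·(1−q^{−(4σ−2)})∕(1−q^{−(4σ−4)})`
telescopes to `μ(𝒪)·G_{L_w}(2σ−1)∕μ(𝒪_w)` (`q_w = q²`), so the closed form is §2's. -/

section Coords

variable {F : Type*} [Field F] [ValuativeRel F] [TopologicalSpace F] [IsNonarchimedeanLocalField F]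

/-- **COORDINATE SHAPE** (`q > 1`, `σ > 1`): `[(1−q^{−2σ})∕(1−q^{1−2σ})]·[(1−q^{−(4σ−2)})∕(1−q^{1−(4σ−2)})]·[(1−q^{−(4σ−3)})∕(1−q^{1−(4σ−3)})]`
`= (1−q^{−2σ})(1+q^{−(2σ−1)})∕[(1−q^{−(2σ−2)})(1+q^{−(2σ−2)})]` (the middle denominator cancels the last numerator; `q^{−(4σ−2)} = (q^{−(2σ−1)})²`,
`q^{−(4σ−4)} = (q^{−(2σ−2)})²`). [folklore] -/
theorem coords_shape_eq {q : ℝ} (hq : 1 < q) {σ : ℝ} (hσ : 1 < σ) :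
    (1 - q ^ (-(2 * σ))) / (1 - q ^ (1 - 2 * σ)) *
        ((1 - q ^ (-(4 * σ - 2))) / (1 - q ^ (1 - (4 * σ - 2))) * ((1 - q ^ (-(4 * σ - 3))) / (1 - q ^ (1 - (4 * σ - 3))))) =
      (1 - q ^ (-(2 * σ))) * (1 + q ^ (-(2 * σ - 1))) / ((1 - q ^ (-(2 * σ - 2))) * (1 + q ^ (-(2 * σ - 2)))) := by
  have hq0 : 0 ≤ q := by linarith
  have hu : q ^ (-(2 * σ - 1)) < 1 := Real.rpow_lt_one_of_one_lt_of_neg hq (by linarith)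
  have hc : q ^ (-(4 * σ - 3)) < 1 := Real.rpow_lt_one_of_one_lt_of_neg hq (by linarith)
  have hu1 : 1 - q ^ (-(2 * σ - 1)) ≠ 0 := by linarith
  have hc1 : 1 - q ^ (-(4 * σ - 3)) ≠ 0 := by linarith
  have hU : q ^ (-(4 * σ - 2)) = (q ^ (-(2 * σ - 1))) ^ 2 := by
    rw [← Real.rpow_mul_natCast hq0]; congr 1; push_cast; ring
  have hW : q ^ (-(4 * σ - 4)) = (q ^ (-(2 * σ - 2))) ^ 2 := by
    rw [← Real.rpow_mul_natCast hq0]; congr 1; push_cast; ring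
  rw [show (1 : ℝ) - 2 * σ = -(2 * σ - 1) by ring, show (1 : ℝ) - (4 * σ - 2) = -(4 * σ - 3) by ring,
    show (1 : ℝ) - (4 * σ - 3) = -(4 * σ - 4) by ring, hU, hW]
  have h1 : 1 - (q ^ (-(2 * σ - 1))) ^ 2 = (1 - q ^ (-(2 * σ - 1))) * (1 + q ^ (-(2 * σ - 1))) := by ring
  have h2 : 1 - (q ^ (-(2 * σ - 2))) ^ 2 = (1 - q ^ (-(2 * σ - 2))) * (1 + q ^ (-(2 * σ - 2))) := by ring
  rw [h1, h2, div_mul_div_comm, div_mul_div_comm,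
    show (1 - q ^ (-(2 * σ))) * ((1 - q ^ (-(2 * σ - 1))) * (1 + q ^ (-(2 * σ - 1))) * (1 - q ^ (-(4 * σ - 3)))) =
      (1 - q ^ (-(2 * σ - 1))) * (1 - q ^ (-(4 * σ - 3))) * ((1 - q ^ (-(2 * σ))) * (1 + q ^ (-(2 * σ - 1)))) by ring,
    show (1 - q ^ (-(2 * σ - 1))) * ((1 - q ^ (-(4 * σ - 3))) * ((1 - q ^ (-(2 * σ - 2))) * (1 + q ^ (-(2 * σ - 2))))) =
      (1 - q ^ (-(2 * σ - 1))) * (1 - q ^ (-(4 * σ - 3))) * ((1 - q ^ (-(2 * σ - 2))) * (1 + q ^ (-(2 * σ - 2)))) by ring,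
    mul_div_mul_left _ _ (mul_ne_zero hu1 hc1)]

/-- `max(1, M²) = max(1, M)²` for `M ≥ 0`. [folklore] -/
theorem max_one_sq_eq {M : ℝ} (hM : 0 ≤ M) : max 1 (M ^ 2) = (max 1 M) ^ 2 := by
  rcases le_total M 1 with h | h
  · rw [max_eq_left (by nlinarith : M ^ 2 ≤ 1), max_eq_left h, one_pow]
  · rw [max_eq_right (by nlinarith : 1 ≤ M ^ 2), max_eq_right h]

/-- **The floor `max(|a|,|b|)²` is a value of `|·|_F`**: `= |a²|` or `|b²|`. [folklore] -/
theorem exists_normAbs_eq_max_sq (a b : F) :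
    ∃ z : F, ((normAbs F z : ℝ≥0) : ℝ) = (max ((normAbs F a : ℝ≥0) : ℝ) ((normAbs F b : ℝ≥0) : ℝ)) ^ 2 := by
  rcases le_total (normAbs F b) (normAbs F a) with h | h
  · refine ⟨a ^ 2, ?_⟩
    have h' : ((normAbs F b : ℝ≥0) : ℝ) ≤ ((normAbs F a : ℝ≥0) : ℝ) := by exact_mod_cast h
    rw [max_eq_left h', map_pow, NNReal.coe_pow]
  · refine ⟨b ^ 2, ?_⟩
    have h' : ((normAbs F a : ℝ≥0) : ℝ) ≤ ((normAbs F b : ℝ≥0) : ℝ) := by exact_mod_cast h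
    rw [max_eq_right h', map_pow, NNReal.coe_pow]

variable [MeasurableSpace F] [BorelSpace F] (μ : Measure F) [μ.IsAddHaarMeasure]

/-- **The `t`-integral with floor `max(|a|,|b|)²`** (every real `s`): `∫_F max(1, max(|a|,|b|)², |t|)^{−s} dμ = max(1, max(|a|,|b|)²)^{1−s}·G(s)` (★ GK `GL₃` §2 at `z = a²` or `b²`).
[cite: Tate1950, §2.2 Lemma 2.2.5] [cite: Casselman1980, Thm. 3.1] -/
theorem integral_max_one_max_sq_rpow_neg (a b : F) (s : ℝ) :
    ∫ t, (max 1 (max ((max ((normAbs F a : ℝ≥0) : ℝ) ((normAbs F b : ℝ≥0) : ℝ)) ^ 2) ((normAbs F t : ℝ≥0) : ℝ))) ^ (-s) ∂μ =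
      (max 1 ((max ((normAbs F a : ℝ≥0) : ℝ) ((normAbs F b : ℝ≥0) : ℝ)) ^ 2)) ^ (1 - s) * ∫ t, (max 1 ((normAbs F t : ℝ≥0) : ℝ)) ^ (-s) ∂μ := by
  obtain ⟨z, hz⟩ := exists_normAbs_eq_max_sq a b
  rw [← hz]
  exact integral_max_one_max_normAbs_rpow_neg μ z s

/-- **INERT TYPE IN BASE COORDINATES, PRODUCT FORM** (every real `σ`, iterated Bochner integrals, integrability-free):
`∫_a ∫_b ∫_t max(1, max(|a|,|b|)², |t|)^{−2σ} dμ dμ dμ = G(2σ) · G(4σ−2) · G(4σ−3)`, `G(s) = ∫_F max(1,|x|)^{−s} dμ` — the `t`-integral has floor `max(|a|,|b|)²`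
(`max(1, M²)^{1−2σ} = max(1, M)^{−(4σ−2)}`), the `b`-integral floor `|a|`. [cite: Langlands1971, §3] [cite: Rogawski1990, §4.5 p. 45] [cite: MoeglinWaldspurger1995, II.1.7] -/
theorem integral_integral_integral_inertCell_coords_eq_prod (σ : ℝ) :
    ∫ a, ∫ b, ∫ t, (max 1 (max ((max ((normAbs F a : ℝ≥0) : ℝ) ((normAbs F b : ℝ≥0) : ℝ)) ^ 2) ((normAbs F t : ℝ≥0) : ℝ))) ^ (-(2 * σ)) ∂μ ∂μ ∂μ =
      (∫ t, (max 1 ((normAbs F t : ℝ≥0) : ℝ)) ^ (-(2 * σ)) ∂μ) *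
        ((∫ t, (max 1 ((normAbs F t : ℝ≥0) : ℝ)) ^ (-(4 * σ - 2)) ∂μ) * ∫ t, (max 1 ((normAbs F t : ℝ≥0) : ℝ)) ^ (-(4 * σ - 3)) ∂μ) := by
  have hsq : ∀ a b : F, (max 1 ((max ((normAbs F a : ℝ≥0) : ℝ) ((normAbs F b : ℝ≥0) : ℝ)) ^ 2)) ^ (1 - 2 * σ) =
      (max 1 (max ((normAbs F a : ℝ≥0) : ℝ) ((normAbs F b : ℝ≥0) : ℝ))) ^ (-(4 * σ - 2)) := by
    intro a b
    have hM : (0 : ℝ) ≤ max ((normAbs F a : ℝ≥0) : ℝ) ((normAbs F b : ℝ≥0) : ℝ) := le_max_of_le_left (NNReal.coe_nonneg _)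
    have h1 : (0 : ℝ) ≤ max 1 (max ((normAbs F a : ℝ≥0) : ℝ) ((normAbs F b : ℝ≥0) : ℝ)) := zero_le_one.trans (le_max_left _ _)
    rw [max_one_sq_eq hM, ← Real.rpow_natCast_mul h1]
    congr 1
    push_cast
    ring
  simp_rw [integral_max_one_max_sq_rpow_neg μ _ _ (2 * σ), hsq, integral_mul_const, integral_max_one_max_normAbs_rpow_neg μ _ (4 * σ - 2),
    integral_mul_const]
  rw [show (1 : ℝ) - (4 * σ - 2) = -(4 * σ - 3) by ring]
  ring

/-- **INERT TYPE IN BASE COORDINATES, CLOSED FORM** (`σ > 1`):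
`∫_a ∫_b ∫_t max(1, max(|a|,|b|)², |t|)^{−2σ} dμ dμ dμ = μ(𝒪)³ · (1 − q^{−2σ})(1 + q^{−(2σ−1)}) ∕ [(1 − q^{−(2σ−2)})(1 + q^{−(2σ−2)})]` — the same rational function of `q^{−σ}` as §2
(`G(4σ−3)G(4σ−2)` telescopes to the short-root factor `(1−q^{−(4σ−2)})∕(1−q^{−(4σ−4)})` of `G_{L_w}(2σ−1)`), now over the SINGLE base field, ready for ★ `AdelicProductIntegral` at `ι = Fin 3`.
[cite: Rogawski1990, §4.5 p. 45] [cite: MoeglinWaldspurger1995, IV.1.11] [cite: Casselman1980, Thm. 3.1] -/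
theorem integral_integral_integral_inertCell_coords_eq {σ : ℝ} (hσ : 1 < σ) :
    ∫ a, ∫ b, ∫ t, (max 1 (max ((max ((normAbs F a : ℝ≥0) : ℝ) ((normAbs F b : ℝ≥0) : ℝ)) ^ 2) ((normAbs F t : ℝ≥0) : ℝ))) ^ (-(2 * σ)) ∂μ ∂μ ∂μ =
      μ.real (primePowBall F 0) ^ 3 *
        ((1 - (residueFieldCard F : ℝ) ^ (-(2 * σ))) * (1 + (residueFieldCard F : ℝ) ^ (-(2 * σ - 1))) /
          ((1 - (residueFieldCard F : ℝ) ^ (-(2 * σ - 2))) * (1 + (residueFieldCard F : ℝ) ^ (-(2 * σ - 2))))) := by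
  rw [integral_integral_integral_inertCell_coords_eq_prod μ σ, integral_max_one_normAbs_rpow_neg μ (by linarith : 1 < 2 * σ),
    integral_max_one_normAbs_rpow_neg μ (by linarith : 1 < 4 * σ - 2), integral_max_one_normAbs_rpow_neg μ (by linarith : 1 < 4 * σ - 3),
    ← coords_shape_eq (one_lt_residueFieldCard_real (F := F)) hσ]
  ring

/-- **INERT TYPE IN BASE COORDINATES, FILE 1's TOKENS** (`σ > 1`): the same with the right-hand side written as FILE 1's Euler factor
`[(1 − q^{−σ})(1 − ε q^{−σ})(1 − ε q^{−(2σ−1)})] ∕ [(1 − q^{−(σ−1)})(1 − ε q^{−(σ−1)})(1 − ε q^{−(2σ−2)})]` at `ε = −1`. [cite: Rogawski1990, §4.5 p. 45] [cite: MoeglinWaldspurger1995, IV.1.11] -/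
theorem integral_integral_integral_inertCell_coords_eq_localScalar {σ : ℝ} (hσ : 1 < σ) :
    ∫ a, ∫ b, ∫ t, (max 1 (max ((max ((normAbs F a : ℝ≥0) : ℝ) ((normAbs F b : ℝ≥0) : ℝ)) ^ 2) ((normAbs F t : ℝ≥0) : ℝ))) ^ (-(2 * σ)) ∂μ ∂μ ∂μ =
      μ.real (primePowBall F 0) ^ 3 *
        ((1 - (residueFieldCard F : ℝ) ^ (-σ)) * (1 - (-1) * (residueFieldCard F : ℝ) ^ (-σ)) * (1 - (-1) * (residueFieldCard F : ℝ) ^ (-(2 * σ - 1))) /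
          ((1 - (residueFieldCard F : ℝ) ^ (-(σ - 1))) * (1 - (-1) * (residueFieldCard F : ℝ) ^ (-(σ - 1))) *
            (1 - (-1) * (residueFieldCard F : ℝ) ^ (-(2 * σ - 2))))) := by
  rw [integral_integral_integral_inertCell_coords_eq μ hσ, localScalar_shape_neg_one_eq (one_pos.trans (one_lt_residueFieldCard_real (F := F))) σ]

end Coords

end Summit.HodgeConjecture.HodgeConjecture.Cruxes.H413.K2E1IntertwiningLocalFactorU3

end
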